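import Literature.NumberTheory.ModularForms.Lemma49Plus8
import HarnessLib

/-!
# CKMRV Lemma 4.9 (4.15) for `𝒦₊^{(8)}|^τ_{4}γ`, `γ ∈ {T, TS}` (general row functions)

Cohn–Kumar–Miller–Radchenko–Viazovska, arXiv:1902.05438, Lemma 4.9 (4.15) and its proof: since
`(𝒦₊^{(d)}|^τ_{d/2} α)(τ,z) = (φ|α)(τ)ᵗ · Υ₊^{(d)}(τ,z) · φ̃(z)` (§4.4, "using the SL₂(ℤ)-automorphy
properties of the matrix entries"), the `τ`-rows of the slashed kernel are `φ|T = φ + (1, E₂, E₂²)`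
and `φ|TS = −φ + (φ̃₋₂, φ̃₀, φ̃₂)`, and (4.15) (`n_{+,τ} = 0`, `n_{+,z} = 2`) follows for `γ = T, TS`
exactly as for `γ = I`: the `q_z⁰`-cancellation is row-independent.

PROVED here: the row-parametrised kernel `plus8Kernel R₋₂ R₀ R₂` (`kernelPlus8 = plus8Kernel φ₋₂ φ₀ φ₂`),
its slashing rule `plus8Kernel_slash` (rows slashed in weights `−2, 0, 2`), the multiplied-out
`S`-twisted form and its uniform bound for rows that are `O(|τ|²)` on half-planes
(`plus8KernelRows_S_bound`), and **(4.15) for `γ = T` and `γ = TS`**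
(`kernelPlus8_T_S_bound_415`, `kernelPlus8_TS_S_bound_415`):
`‖(𝒦₊^{(8)}|₄γ)(τ,Sz)z²Δ(τ)Δ(z)(j(τ)−j(z))‖ ≤ C|τ|²|z|²e^{−2π Im z}` on `Im τ, Im z ≥ δ`.

## References

* H. Cohn, A. Kumar, S. D. Miller, D. Radchenko, M. Viazovska, Ann. of Math. 196 (2022),
  arXiv:1902.05438, Lemma 4.9 (4.15); §4.4. [CohnEtAl2019]
-/

noncomputable section

open Complex hiding I
open Filter Topology Asymptotics ModularForm SlashInvariantForm EisensteinSeries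
open UpperHalfPlane hiding I
open Complex (I)
open scoped Real MatrixGroups ModularForm Manifold

namespace Literature.NumberTheory.ModularForms

open Literature.NumberTheory.EllipticCurves.ModularForms (kleinJ kleinJ_smul E₄_cube_eq_kleinJ_mul)

/-! ## The row-parametrised kernel -/

/-- `𝒦₊^{(8)}` with arbitrary row functions `R₋₂, R₀, R₂` in place of `φ₋₂, φ₀, φ₂`. [cite: CohnEtAl2019, §4.4 (4.13)] -/
def plus8Kernel (Rm R0 R2 : ℍ → ℂ) (τ z : ℍ) : ℂ :=
  (π : ℂ) ^ 2 / (36 * I) / (ModularForm.discriminant z * (kleinJ τ - kleinJ z)) *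
    (Rm τ * E₆ τ * ((kleinJ τ - kleinJ z) * ModularForm.discriminant z * phiTildeNeg2 z +
        E8fun z * phiTilde2 z) +
      R0 τ * E₄ τ * (-2 * (kleinJ τ - kleinJ z) * ModularForm.discriminant z * phiTildeNeg2 z -
        2 * E10fun z * phiTilde0 z) +
      R2 τ * f2fun τ * (ModularForm.discriminant z * phiTildeNeg2 z))

/-- `𝒦₊^{(8)} = plus8Kernel φ₋₂ φ₀ φ₂`. [cite: CohnEtAl2019, §4.4 (4.13)] -/
theorem kernelPlus8_eq_plus8Kernel : kernelPlus8 = plus8Kernel phiNeg2 phi0 phi2 := rfl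

/-- **Slashing acts on the rows**: `(plus8Kernel R · z)|₄γ = plus8Kernel (R₋₂|₋₂γ) (R₀|₀γ) (R₂|₂γ) · z`.
[cite: CohnEtAl2019, §4.4] -/
theorem plus8Kernel_slash (Rm R0 R2 : ℍ → ℂ) (z : ℍ) (γ : SL(2, ℤ)) :
    (fun τ => plus8Kernel Rm R0 R2 τ z) ∣[(4 : ℤ)] γ =
      fun τ => plus8Kernel (Rm ∣[(-2 : ℤ)] γ) (R0 ∣[(0 : ℤ)] γ) (R2 ∣[(2 : ℤ)] γ) τ z := by
  set c : ℂ := (π : ℂ) ^ 2 / (36 * I) with hc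
  set a₁ : ℍ → ℂ := ⇑E₆ * fun τ => c / (ModularForm.discriminant z * (kleinJ τ - kleinJ z)) *
    ((kleinJ τ - kleinJ z) * ModularForm.discriminant z * phiTildeNeg2 z + E8fun z * phiTilde2 z) with ha₁
  set a₂ : ℍ → ℂ := ⇑E₄ * fun τ => c / (ModularForm.discriminant z * (kleinJ τ - kleinJ z)) *
    (-2 * (kleinJ τ - kleinJ z) * ModularForm.discriminant z * phiTildeNeg2 z -
      2 * E10fun z * phiTilde0 z) with ha₂
  set a₃ : ℍ → ℂ := f2fun * fun τ => c / (ModularForm.discriminant z * (kleinJ τ - kleinJ z)) *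
    (ModularForm.discriminant z * phiTildeNeg2 z) with ha₃
  have h₁ : IsLevelOneInvariant (4 + 2) a₁ :=
    (isLevelOneInvariant_E₆.mul (isLevelOneInvariant_comp_kleinJ fun j =>
      c / (ModularForm.discriminant z * (j - kleinJ z)) *
        ((j - kleinJ z) * ModularForm.discriminant z * phiTildeNeg2 z + E8fun z * phiTilde2 z))).cast
      (by norm_num)
  have h₂ : IsLevelOneInvariant 4 a₂ :=
    (isLevelOneInvariant_E₄.mul (isLevelOneInvariant_comp_kleinJ fun j =>
      c / (ModularForm.discriminant z * (j - kleinJ z)) *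
        (-2 * (j - kleinJ z) * ModularForm.discriminant z * phiTildeNeg2 z -
          2 * E10fun z * phiTilde0 z))).cast (by norm_num)
  have h₃ : IsLevelOneInvariant (4 - 2) a₃ :=
    (isLevelOneInvariant_f2.mul (isLevelOneInvariant_comp_kleinJ fun j =>
      c / (ModularForm.discriminant z * (j - kleinJ z)) *
        (ModularForm.discriminant z * phiTildeNeg2 z))).cast (by norm_num)
  have key : ∀ (Sm S0 S2 : ℍ → ℂ), (fun τ => plus8Kernel Sm S0 S2 τ z) = Sm * a₁ + S0 * a₂ + S2 * a₃ := by
    intro Sm S0 S2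
    funext τ
    simp only [plus8Kernel, ha₁, ha₂, ha₃, hc, Pi.add_apply, Pi.mul_apply]
    ring
  rw [key, key, SlashAction.add_slash, SlashAction.add_slash, show (4 : ℤ) = -2 + (4 + 2) by norm_num,
    mul_slash_SL2, h₁ γ, show (-2 : ℤ) + (4 + 2) = 0 + 4 by norm_num, mul_slash_SL2, h₂ γ,
    show (0 : ℤ) + 4 = 2 + (4 - 2) by norm_num, mul_slash_SL2, h₃ γ]

/-! ## The multiplied-out `S`-twist for general rows -/

/-- The bracket with general rows. [cite: CohnEtAl2019, Lemma 4.9 (proof)] -/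
def plus8RowsBracket (Rm R0 R2 : ℍ → ℂ) (τ z : ℍ) : ℂ :=
  (π : ℂ) ^ 2 / (36 * I) *
    (Rm τ * E₆ τ * ((E₄ τ ^ 3 * ModularForm.discriminant z - E₄ z ^ 3 * ModularForm.discriminant τ) +
        ModularForm.discriminant τ * (E8fun z * E2 z ^ 2)) -
      2 * R0 τ * E₄ τ * ((E₄ τ ^ 3 * ModularForm.discriminant z - E₄ z ^ 3 * ModularForm.discriminant τ) +
        ModularForm.discriminant τ * (E10fun z * E2 z)) +
      R2 τ * E14fun τ * ModularForm.discriminant z)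

/-- `plus8Kernel_S_mul_eq` (auxiliary). [cite: CohnEtAl2019, Lemma 4.9 (proof)] -/
theorem plus8Kernel_S_mul_eq (Rm R0 R2 : ℍ → ℂ) (τ z : ℍ) (hJ : kleinJ τ - kleinJ z ≠ 0) :
    plus8Kernel Rm R0 R2 τ (ModularGroup.S • z) * (z : ℂ) ^ 2 *
      (ModularForm.discriminant τ * ModularForm.discriminant z * (kleinJ τ - kleinJ z)) = plus8RowsBracket Rm R0 R2 τ z := by
  have hz : (z : ℂ) ≠ 0 := z.ne_zero
  have hΔz := ModularForm.discriminant_ne_zero z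
  have hΔτ := ModularForm.discriminant_ne_zero τ
  have hjz : kleinJ z * ModularForm.discriminant z = E₄ z ^ 3 := (E₄_cube_eq_kleinJ_mul z).symm
  have hjτ : kleinJ τ * ModularForm.discriminant τ = E₄ τ ^ 3 := (E₄_cube_eq_kleinJ_mul τ).symm
  simp only [plus8Kernel, plus8RowsBracket, kleinJ_smul, discriminant_S_smul', phiTildeNeg2_S_smul, phiTilde0_S_smul,
    phiTilde2_S_smul, E8fun, E10fun, E14fun, f2fun, Pi.mul_apply, Pi.inv_apply, E₄_S_smul, E₆_S_smul]
  field_simp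
  have e1 : kleinJ τ = E₄ τ ^ 3 / ModularForm.discriminant τ := by rw [eq_div_iff hΔτ]; exact hjτ
  have e2 : kleinJ z = E₄ z ^ 3 / ModularForm.discriminant z := by rw [eq_div_iff hΔz]; exact hjz
  rw [e1, e2]
  field_simp
  ring

/-- `norm_plus8Kernel_S_mul_le` (auxiliary). [cite: CohnEtAl2019, Lemma 4.9 (proof)] -/
theorem norm_plus8Kernel_S_mul_le (Rm R0 R2 : ℍ → ℂ) (τ z : ℍ) :
    ‖plus8Kernel Rm R0 R2 τ (ModularGroup.S • z) * (z : ℂ) ^ 2 *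
      (ModularForm.discriminant τ * ModularForm.discriminant z * (kleinJ τ - kleinJ z))‖ ≤ ‖plus8RowsBracket Rm R0 R2 τ z‖ := by
  by_cases hJ : kleinJ τ - kleinJ z = 0
  · rw [hJ]; simp
  · rw [plus8Kernel_S_mul_eq Rm R0 R2 τ z hJ]

/-- The `q_z⁰`-cancellation for general rows. [cite: CohnEtAl2019, Lemma 4.9 (proof)] -/
theorem plus8RowsBracket_decomp (Rm R0 R2 : ℍ → ℂ) (τ z : ℍ) : plus8RowsBracket Rm R0 R2 τ z = (π : ℂ) ^ 2 / (36 * I) *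
    ( Rm τ * (E₆ τ * E₄ τ ^ 3) * ModularForm.discriminant z
      - 2 * (R0 τ * E₄ τ ^ 4 * ModularForm.discriminant z)
      + R2 τ * E14fun τ * ModularForm.discriminant z
      - Rm τ * E₆ τ * ModularForm.discriminant τ * (E₄ z ^ 3 - 1)
      + Rm τ * E₆ τ * ModularForm.discriminant τ * (E8fun z * E2 z ^ 2 - 1)
      + 2 * (R0 τ * E₄ τ * ModularForm.discriminant τ * (E₄ z ^ 3 - 1))
      - 2 * (R0 τ * E₄ τ * ModularForm.discriminant τ * (E10fun z * E2 z - 1)) ) := by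
  simp only [plus8RowsBracket, E14fun, E10fun, E8fun, Pi.mul_apply]
  ring

/-- **Uniform bound for `O(|τ|²)` rows**: if `R₋₂, R₀, R₂ = O(|τ|²)` on `Im τ ≥ δ` then
`bracket_R(τ,z) = O(|τ|² e^{−2π Im z})` on `{Im τ ≥ δ} × {Im z ≥ δ}`. [cite: CohnEtAl2019, Lemma 4.9 (4.15)] -/
theorem plus8RowsBracket_isBigO {δ : ℝ} (hδ : 0 < δ) {Rm R0 R2 : ℍ → ℂ}
    (hm : Rm =O[𝓟 (halfPlane δ)] fun τ : ℍ => ‖(τ : ℂ)‖ ^ 2) (h0 : R0 =O[𝓟 (halfPlane δ)] fun τ : ℍ => ‖(τ : ℂ)‖ ^ 2)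
    (h2 : R2 =O[𝓟 (halfPlane δ)] fun τ : ℍ => ‖(τ : ℂ)‖ ^ 2) :
    (fun p : ℍ × ℍ => plus8RowsBracket Rm R0 R2 p.1 p.2) =O[𝓟 (halfPlane δ ×ˢ halfPlane δ)]
      fun p => ‖(p.1 : ℂ)‖ ^ 2 * expDecay p.2 := by
  obtain ⟨h4, h6, hE2m, hΔ, hE4, hE6, hE2, h1, hcoe, hq1⟩ := halfPlane_isBigO_basic hδ
  obtain ⟨f1, f2, f3, f4, f5, f6, f7, f8, z1, z2, z3⟩ := halfPlane_isBigO_factors hδ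
  set F := 𝓟 (halfPlane δ ×ˢ halfPlane δ) with hF
  have bb : ∀ {u v : ℍ → ℂ}, u =O[𝓟 (halfPlane δ)] (fun _ : ℍ => (1 : ℝ)) → v =O[𝓟 (halfPlane δ)] (fun _ : ℍ => (1 : ℝ)) →
      (fun τ => u τ * v τ) =O[𝓟 (halfPlane δ)] fun _ : ℍ => (1 : ℝ) := fun hu hv => by simpa using hu.mul hv
  have hE4_3 : (fun τ : ℍ => E₄ τ ^ 3) =O[𝓟 (halfPlane δ)] fun _ : ℍ => (1 : ℝ) := by
    have h2' : (fun τ : ℍ => E₄ τ ^ 2) =O[𝓟 (halfPlane δ)] fun _ : ℍ => (1 : ℝ) := by simpa [sq] using bb hE4 hE4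
    simpa [pow_succ] using bb h2' hE4
  -- `a(τ) · u(τ) · c(z)` with `a = O(|τ|²)`, `u = O(1)`, `c = O(q_z)`
  have T : ∀ {a u c : ℍ → ℂ}, a =O[𝓟 (halfPlane δ)] (fun τ : ℍ => ‖(τ : ℂ)‖ ^ 2) →
      u =O[𝓟 (halfPlane δ)] (fun _ : ℍ => (1 : ℝ)) → c =O[𝓟 (halfPlane δ)] expDecay →
      (fun p : ℍ × ℍ => a p.1 * u p.1 * c p.2) =O[F] fun p => ‖(p.1 : ℂ)‖ ^ 2 * expDecay p.2 := by
    intro a u c ha hu hc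
    have := ((isBigO_fst_of_halfPlane ha).mul (isBigO_fst_of_halfPlane hu)).mul (isBigO_snd_of_halfPlane hc)
    simpa using this
  -- `Δ(τ) = O(1)` as a bounded factor (weaker than `O(q_τ)`, enough here)
  have hΔ1 : (ModularForm.discriminant : ℍ → ℂ) =O[𝓟 (halfPlane δ)] fun _ : ℍ => (1 : ℝ) := hΔ.trans hq1
  have s1 := T hm (bb hE6 hE4_3) hΔ
  have s2 := T h0 f3 hΔ
  have s3 := T h2 f5 hΔ
  have s4 := T hm (bb hE6 hΔ1) z1
  have s5 := T hm (bb hE6 hΔ1) z2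
  have s6 := T h0 (bb hE4 hΔ1) z1
  have s7 := T h0 (bb hE4 hΔ1) z3
  have total := ((((((s1.sub (s2.const_mul_left 2)).add s3).sub s4).add s5).add (s6.const_mul_left 2)).sub
    (s7.const_mul_left 2)).const_mul_left ((π : ℂ) ^ 2 / (36 * I))
  refine total.congr_left fun p => ?_
  rw [plus8RowsBracket_decomp]
  ring

/-- **(4.15) for general `O(|τ|²)` rows** (multiplied-out): `‖plus8Kernel R τ (Sz) z² ΔτΔzJ‖ ≤ C|τ|²|z|²e^{−2π Im z}`.
[cite: CohnEtAl2019, Lemma 4.9 (4.15)] -/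
theorem plus8KernelRows_S_bound {δ : ℝ} (hδ : 0 < δ) {Rm R0 R2 : ℍ → ℂ}
    (hm : Rm =O[𝓟 (halfPlane δ)] fun τ : ℍ => ‖(τ : ℂ)‖ ^ 2) (h0 : R0 =O[𝓟 (halfPlane δ)] fun τ : ℍ => ‖(τ : ℂ)‖ ^ 2)
    (h2 : R2 =O[𝓟 (halfPlane δ)] fun τ : ℍ => ‖(τ : ℂ)‖ ^ 2) :
    ∃ C : ℝ, ∀ τ z : ℍ, δ ≤ τ.im → δ ≤ z.im →
      ‖plus8Kernel Rm R0 R2 τ (ModularGroup.S • z) * (z : ℂ) ^ 2 *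
        (ModularForm.discriminant τ * ModularForm.discriminant z * (kleinJ τ - kleinJ z))‖
          ≤ C * (‖(τ : ℂ)‖ ^ 2 * ‖(z : ℂ)‖ ^ 2 * expDecay z) := by
  obtain ⟨C, hC⟩ := isBigO_principal.1 (plus8RowsBracket_isBigO hδ hm h0 h2)
  refine ⟨|C| / δ ^ 2, fun τ z hτ hz => (norm_plus8Kernel_S_mul_le Rm R0 R2 τ z).trans ?_⟩
  have h := hC (τ, z) ⟨hτ, hz⟩
  rw [Real.norm_of_nonneg (mul_nonneg (sq_nonneg _) (expDecay_pos _).le)] at h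
  refine h.trans ?_
  have hz1 : δ ≤ ‖(z : ℂ)‖ := hz.trans (im_le_norm_coe z)
  have hq := expDecay_pos z
  have h1 : C * (‖(τ : ℂ)‖ ^ 2 * expDecay z) ≤ |C| * (‖(τ : ℂ)‖ ^ 2 * expDecay z) :=
    mul_le_mul_of_nonneg_right (le_abs_self C) (mul_nonneg (sq_nonneg _) hq.le)
  refine h1.trans ?_
  rw [show |C| / δ ^ 2 * (‖(τ : ℂ)‖ ^ 2 * ‖(z : ℂ)‖ ^ 2 * expDecay z) =
    |C| * (‖(τ : ℂ)‖ ^ 2 * expDecay z) * (‖(z : ℂ)‖ / δ) ^ 2 by field_simp]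
  refine le_mul_of_one_le_right (mul_nonneg (abs_nonneg C) (mul_nonneg (sq_nonneg _) hq.le)) ?_
  have b : 1 ≤ ‖(z : ℂ)‖ / δ := by rw [le_div_iff₀ hδ]; linarith
  exact one_le_pow₀ b

/-! ## The rows `φ|T = φ + (1, E₂, E₂²)` and `φ|TS = −φ + φ̃` -/

/-- The slashed rows for `γ = T`. [cite: CohnEtAl2019, §4.2 Proposition 4.4] -/
theorem phi_rows_slash_T :
    phiNeg2 ∣[(-2 : ℤ)] ModularGroup.T = phiNeg2 + 1 ∧ phi0 ∣[(0 : ℤ)] ModularGroup.T = phi0 + E2 ∧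
    phi2 ∣[(2 : ℤ)] ModularGroup.T = phi2 + E2 ^ 2 := by
  refine ⟨?_, ?_, ?_⟩ <;> funext τ <;> rw [slash_T_apply]
  · rw [phiNeg2_vadd_one]; rfl
  · rw [phi0_vadd_one]; rfl
  · rw [phi2_vadd_one]; rfl

/-- The slashed rows for `γ = TS`: `(φⱼ|T)|S = φⱼ|S + (1, E₂, E₂²)|S = −φⱼ + φ̃ⱼ`.
[cite: CohnEtAl2019, §4.2 Propositions 4.4] -/
theorem phi_rows_slash_TS :
    phiNeg2 ∣[(-2 : ℤ)] (ModularGroup.T * ModularGroup.S) = -phiNeg2 + phiTildeNeg2 ∧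
    phi0 ∣[(0 : ℤ)] (ModularGroup.T * ModularGroup.S) = -phi0 + phiTilde0 ∧
    phi2 ∣[(2 : ℤ)] (ModularGroup.T * ModularGroup.S) = -phi2 + phiTilde2 := by
  obtain ⟨hT1, hT2, hT3⟩ := phi_rows_slash_T
  refine ⟨?_, ?_, ?_⟩
  · rw [SlashAction.slash_mul, hT1]
    funext τ
    rw [slash_S_apply', Pi.add_apply, Pi.add_apply, Pi.neg_apply, phiNeg2_S_smul, Pi.one_apply]
    have hτ : (τ : ℂ) ≠ 0 := τ.ne_zero
    simp only [phiNeg2, phiTildeNeg2, zpow_neg, zpow_ofNat, inv_inv]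
    field_simp
  · rw [SlashAction.slash_mul, hT2]
    funext τ
    rw [slash_S_apply', Pi.add_apply, Pi.add_apply, Pi.neg_apply, phi0_S_smul, E2_S_smul, neg_zero, zpow_zero, mul_one]
    simp only [phiTilde0]
  · rw [SlashAction.slash_mul, hT3]
    funext τ
    rw [slash_S_apply', Pi.add_apply, Pi.add_apply, Pi.neg_apply, Pi.pow_apply, phi2_S_smul, E2_S_smul]
    have hτ : (τ : ℂ) ≠ 0 := τ.ne_zero
    simp only [phiTilde2, zpow_neg, zpow_ofNat]
    field_simp

/-- The new rows are `O(|τ|²)` on half-planes: `1, E₂, E₂², φ̃₋₂, φ̃₀, φ̃₂` (and `φⱼ`). [cite: CohnEtAl2019, §4.2] -/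
theorem rows_isBigO_sq {δ : ℝ} (hδ : 0 < δ) :
    ((phiNeg2 + 1) =O[𝓟 (halfPlane δ)] fun τ : ℍ => ‖(τ : ℂ)‖ ^ 2) ∧
    ((phi0 + E2) =O[𝓟 (halfPlane δ)] fun τ : ℍ => ‖(τ : ℂ)‖ ^ 2) ∧
    ((phi2 + E2 ^ 2) =O[𝓟 (halfPlane δ)] fun τ : ℍ => ‖(τ : ℂ)‖ ^ 2) ∧
    ((-phiNeg2 + phiTildeNeg2) =O[𝓟 (halfPlane δ)] fun τ : ℍ => ‖(τ : ℂ)‖ ^ 2) ∧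
    ((-phi0 + phiTilde0) =O[𝓟 (halfPlane δ)] fun τ : ℍ => ‖(τ : ℂ)‖ ^ 2) ∧
    ((-phi2 + phiTilde2) =O[𝓟 (halfPlane δ)] fun τ : ℍ => ‖(τ : ℂ)‖ ^ 2) := by
  obtain ⟨_, _, _, _, _, _, hE2, h1, hcoe, _⟩ := halfPlane_isBigO_basic hδ
  obtain ⟨hφm, hφ0, hφ2⟩ := halfPlane_isBigO_phi hδ
  -- `|τ| = O(|τ|²)` and `1 = O(|τ|²)` on `Im τ ≥ δ`
  have up : ∀ {f : ℍ → ℂ}, f =O[𝓟 (halfPlane δ)] (fun τ : ℍ => ‖(τ : ℂ)‖) → f =O[𝓟 (halfPlane δ)] fun τ : ℍ => ‖(τ : ℂ)‖ ^ 2 := by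
    intro f hf
    refine hf.trans ?_
    rw [isBigO_principal]
    refine ⟨1 / δ, fun τ hτ => ?_⟩
    have hτ1 : δ ≤ ‖(τ : ℂ)‖ := (mem_halfPlane.1 hτ).trans (im_le_norm_coe τ)
    rw [norm_norm, Real.norm_of_nonneg (sq_nonneg _), sq, one_div, ← mul_assoc, inv_mul_eq_div]
    exact le_mul_of_one_le_left (norm_nonneg _) (by rw [le_div_iff₀ hδ, one_mul]; exact hτ1)
  have hone : (fun _ : ℍ => (1 : ℂ)) =O[𝓟 (halfPlane δ)] fun τ : ℍ => ‖(τ : ℂ)‖ ^ 2 := up h1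
  have hE2' : E2 =O[𝓟 (halfPlane δ)] fun τ : ℍ => ‖(τ : ℂ)‖ ^ 2 := up (by simpa using h1.mul hE2)
  have hE2sq : (fun τ => E2 τ * E2 τ) =O[𝓟 (halfPlane δ)] fun τ : ℍ => ‖(τ : ℂ)‖ := by
    simpa using (h1.mul hE2).mul hE2
  have hE22 : (E2 ^ 2) =O[𝓟 (halfPlane δ)] fun τ : ℍ => ‖(τ : ℂ)‖ ^ 2 := (up hE2sq).congr_left fun τ => by simp [sq]
  have hsq : (fun τ : ℍ => (τ : ℂ) ^ 2) =O[𝓟 (halfPlane δ)] fun τ : ℍ => ‖(τ : ℂ)‖ ^ 2 := by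
    simpa [sq] using hcoe.mul hcoe
  have ht0 : phiTilde0 =O[𝓟 (halfPlane δ)] fun τ : ℍ => ‖(τ : ℂ)‖ ^ 2 := by
    have t1 : (fun τ : ℍ => (τ : ℂ) ^ 2 * E2 τ) =O[𝓟 (halfPlane δ)] fun τ : ℍ => ‖(τ : ℂ)‖ ^ 2 := by
      simpa using hsq.mul hE2
    have t2 : (fun τ : ℍ => 6 * I * (τ : ℂ) / π) =O[𝓟 (halfPlane δ)] fun τ : ℍ => ‖(τ : ℂ)‖ ^ 2 := by
      have := up hcoe
      exact (this.const_mul_left (6 * I / π)).congr_left fun τ => by ring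
    exact (t1.sub t2).congr_left fun τ => by simp [phiTilde0]
  have ht2 : phiTilde2 =O[𝓟 (halfPlane δ)] fun τ : ℍ => ‖(τ : ℂ)‖ ^ 2 := by
    -- `(τE₂ − 6i/π)² = τ²E₂² − (12i/π)τE₂ − 36/π²`
    have t1 : (fun τ : ℍ => (τ : ℂ) ^ 2 * E2 τ ^ 2) =O[𝓟 (halfPlane δ)] fun τ : ℍ => ‖(τ : ℂ)‖ ^ 2 := by
      simpa [sq] using hsq.mul (hE2.mul hE2)
    have t2 : (fun τ : ℍ => (τ : ℂ) * E2 τ) =O[𝓟 (halfPlane δ)] fun τ : ℍ => ‖(τ : ℂ)‖ ^ 2 := up (by simpa using hcoe.mul hE2)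
    have := (t1.sub (t2.const_mul_left (12 * I / π))).sub (hone.const_mul_left (36 / π ^ 2 : ℂ))
    refine this.congr_left fun τ => ?_
    have hπ : (π : ℂ) ≠ 0 := ofReal_ne_zero.2 Real.pi_ne_zero
    simp only [phiTilde2]
    field_simp
    ring_nf
    rw [I_sq]
    ring
  refine ⟨(up hφm).add hone, (up hφ0).add hE2', (up hφ2).add hE22, (up hφm).neg_left.add (hsq.congr_left fun τ => rfl),
    (up hφ0).neg_left.add ht0, (up hφ2).neg_left.add ht2⟩

/-- **Lemma 4.9 (4.15) for `𝒦₊^{(8)}|₄T`** (multiplied-out form). [cite: CohnEtAl2019, Lemma 4.9 (4.15)] -/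
theorem kernelPlus8_T_S_bound_415 {δ : ℝ} (hδ : 0 < δ) : ∃ C : ℝ, ∀ τ z : ℍ, δ ≤ τ.im → δ ≤ z.im →
    ‖((fun σ => kernelPlus8 σ (ModularGroup.S • z)) ∣[(4 : ℤ)] ModularGroup.T) τ * (z : ℂ) ^ 2 *
      (ModularForm.discriminant τ * ModularForm.discriminant z * (kleinJ τ - kleinJ z))‖
        ≤ C * (‖(τ : ℂ)‖ ^ 2 * ‖(z : ℂ)‖ ^ 2 * expDecay z) := by
  obtain ⟨hT1, hT2, hT3⟩ := phi_rows_slash_T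
  obtain ⟨r1, r2, r3, _, _, _⟩ := rows_isBigO_sq hδ
  obtain ⟨C, hC⟩ := plus8KernelRows_S_bound hδ r1 r2 r3
  refine ⟨C, fun τ z hτ hz => ?_⟩
  have h := hC τ z hτ hz
  rw [kernelPlus8_eq_plus8Kernel, plus8Kernel_slash, hT1, hT2, hT3]
  exact h

/-- **Lemma 4.9 (4.15) for `𝒦₊^{(8)}|₄TS`** (multiplied-out form). [cite: CohnEtAl2019, Lemma 4.9 (4.15)] -/
theorem kernelPlus8_TS_S_bound_415 {δ : ℝ} (hδ : 0 < δ) : ∃ C : ℝ, ∀ τ z : ℍ, δ ≤ τ.im → δ ≤ z.im →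
    ‖((fun σ => kernelPlus8 σ (ModularGroup.S • z)) ∣[(4 : ℤ)] (ModularGroup.T * ModularGroup.S)) τ * (z : ℂ) ^ 2 *
      (ModularForm.discriminant τ * ModularForm.discriminant z * (kleinJ τ - kleinJ z))‖
        ≤ C * (‖(τ : ℂ)‖ ^ 2 * ‖(z : ℂ)‖ ^ 2 * expDecay z) := by
  obtain ⟨hS1, hS2, hS3⟩ := phi_rows_slash_TS
  obtain ⟨_, _, _, r1, r2, r3⟩ := rows_isBigO_sq hδ
  obtain ⟨C, hC⟩ := plus8KernelRows_S_bound hδ r1 r2 r3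
  refine ⟨C, fun τ z hτ hz => ?_⟩
  have h := hC τ z hτ hz
  rw [kernelPlus8_eq_plus8Kernel, plus8Kernel_slash, hS1, hS2, hS3]
  exact h

end Literature.NumberTheory.ModularForms
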